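import Literature.NumberTheory.Automorphic.CompactQuotientFiniteMultiplicity
import HarnessLib

/-!
# Crux `H413`, ENGINE T1 line `F0_T1InnerFormTraceIdentity` — anchor fact A2 `FactT1aMultiplicityFinite`:
# finite multiplicities in `L²(U(H)(L⁺)\U(H)(𝔸_{L⁺}))` for anisotropic `H` (the fold of the by-name hypothesis `hA2`)

Cell hodgecm-mathlib, FLOOR 0, crux item H413 = stmt-HodgeConjecture-24833; programme P3a (ENGINE T1), registered line
`Cruxes/H413/Lines/F0_T1InnerFormTraceIdentity.lean`; pool task «A2-BUILD» of F0P3a-plan (g0) 2026-08-30T23:03:22Z, seat F0P3a-p08 (g0).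
PROOF lane, one theorem; `--supports stmt-HodgeConjecture-24833 --as helper`.  Theorems never import `Cruxes/…/Lines`: the fact's
statement is repeated BY VALUE — the TYPE of `factT1a_multiplicityFinite L H μ` is the body of

`def FactT1aMultiplicityFinite (H : Matrix (Fin 3) (Fin 3) L) (μ : Measure (UnitaryGroup.cmDatum L 3 H).automorphicQuotient)
    [(UnitaryGroup.cmDatum L 3 H).IsAutomorphicMeasure μ] : Prop :=
  (∀ x : Fin 3 → L, hermForm (cmConjRingHom L) H x x = 0 → x = 0) → multiplicity_lt_top_of_mem_discreteSpectrum (UnitaryGroup.cmDatum L 3 H) μ`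

(Lines file ll. 448–451), i.e. «for anisotropic `H` every discrete automorphic representation of `U(H)(𝔸_{L⁺})` occurs in `L²` with FINITE
multiplicity» — [Rogawski1990, §14.5 p. 237] («Since `G′` is anisotropic, `T_{G′}(f′)` is the trace of `ρ(f′)` on `L(G′)`», the
`χ`-expansion with multiplicities `m(π)`), [GelfandGraevPiatetskiShapiro1969, Ch. 1 §2.3] (compact quotient ⇒ discrete spectrum with
finite multiplicities).  It is ★ IN THE TREE as `UnitaryGroup.multiplicity_lt_top_of_mem_discreteSpectrum_cmDatum` (`Literature/
NumberTheory/Automorphic/CompactQuotientFiniteMultiplicity.lean`, [DeitmarEchterhoff2014, Thm. 9.2.2] on the compact quotient ★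
`compactSpace_cmDatum_automorphicQuotient`); the registered line (ed. 1.1–1.7) carried it as the by-name hypothesis `hA2` of
`anchoredKit_nonempty_of_stubs` ∕ `engineT1_of_stubs` only because that module was unbuilt on the farm snapshot at typing time.  This file
is the one-line fold; payoff: the next line edition drops the binder `hA2`.

HC_CM is proved only modulo the printed citations until rung 0 closes; this file proves nothing about them.
-/

-- the mandated namespace repeats `HodgeConjecture.HodgeConjecture`, as in every `Theorems/*.lean` of this sub-problem
set_option linter.dupNamespace false
set_option autoImplicit false

noncomputable section

open MeasureTheory Measure NumberField
open Literature.NumberTheory.Automorphic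
open Literature.AlgebraicGeometry.ShimuraVarieties (hermForm)

namespace Summit.HodgeConjecture.HodgeConjecture.Cruxes.H413.F0P3aFactA2Multiplicity

variable (L : Type) [Field L] [NumberField L] [IsCMField L]

/-- **Anchor fact A2 of the T1 line, PROVED (★ fold)**: for an anisotropic `H ∈ M₃(L)` over the CM field `L` and any automorphic
measure `μ` on `U(H)(L⁺)\U(H)(𝔸_{L⁺})`, every discrete automorphic representation of `U(H)` has finite multiplicity in `L²(μ)` — the
TYPE is the body of the line's `FactT1aMultiplicityFinite L H μ` verbatim; the proof is the tree's
★ `UnitaryGroup.multiplicity_lt_top_of_mem_discreteSpectrum_cmDatum` at `N = 3`.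
[cite: Rogawski1990, §14.5 p. 237] [cite: DeitmarEchterhoff2014, Thm. 9.2.2] -/
theorem factT1a_multiplicityFinite (H : Matrix (Fin 3) (Fin 3) L)
    (μ : Measure (UnitaryGroup.cmDatum L 3 H).automorphicQuotient) [(UnitaryGroup.cmDatum L 3 H).IsAutomorphicMeasure μ] :
    (∀ x : Fin 3 → L, hermForm (cmConjRingHom L) H x x = 0 → x = 0) →
      multiplicity_lt_top_of_mem_discreteSpectrum (UnitaryGroup.cmDatum L 3 H) μ :=
  fun hanis => UnitaryGroup.multiplicity_lt_top_of_mem_discreteSpectrum_cmDatum L 3 H hanis μ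

end Summit.HodgeConjecture.HodgeConjecture.Cruxes.H413.F0P3aFactA2Multiplicity
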